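import Mathlib
import HarnessLib

/-!
# Crux `DigitPolyUniformity` (stmt-QuantumAdvantage-1392), line `Sketch`, cycle 7 — Stub KMT window
# average in a residue class: an aligned block against the windows to its right

The Klurman–Mangerel–Teräväinen theorem controls the sums of a `1`-bounded sequence `c` over the
WINDOWS `(m, m + H] ∩ {n : n % q = a}` on average over the left end-point `m`; the lead needs the
ALIGNED BLOCKS `[B, B + H) ∩ {n : n % q = a}`. This file compares one block with the `T ≤ H`
windows immediately to its right: for `m ∈ [B, B + T)` the block `[B, B + H)` and the window
`(m, m + H] = [m + 1, m + H + 1)` share the part `[m + 1, B + H)`, so that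

  `S_block − W_m = Σ_{[B, m+1) ∩ class} c − Σ_{[B+H, m+H+1) ∩ class} c`     (`block_sub_window_eq`),

two class sums over `m + 1 − B ≤ T` consecutive integers each; an interval of `L` consecutive
integers contains at most `L / q + 1` members of the class `{n : n % q = a}` (`card_filter_mod_le`),
so `|S_block − W_m| ≤ 2 (T / q + 1)` (`block_sub_window_le`); averaging over the `T` values of `m`,

  `|S_block| ≤ T⁻¹ Σ_{m ∈ [B, B+T)} |W_m| + 2 (T / q + 1)`     (`stub_kmt_window_average_AP`).

No hypothesis `0 < q` is needed: for `q = 0` the class is the single point `{a}` (`n % 0 = n`) and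
`T / 0 = 0` in `ℝ`. Mathlib only; no named facts.
-/

noncomputable section

namespace Summit.QuantumAdvantage.DigitPolyUniformity.SketchLAR.KMT

open Finset

/-- **Counting a residue class in an interval.** An interval of `L` consecutive naturals contains
at most `L / q + 1` naturals `n` with `n % q = a`: for `q = 0` the class is `⊆ {a}`; for `0 < q`
the map `n ↦ (n − u) / q` is injective on the class inside `[u, u + L)` (two members with the same
quotient are congruent mod `q` and differ by `< q`, `Nat.ModEq.eq_of_abs_lt`) with image in
`[0, (L − 1) / q]`, and `(L − 1) / q ≤ L / q` (`Nat.cast_div_le`). [folklore] -/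
private lemma card_filter_mod_le (q a u L : ℕ) :
    ((((Ico u (u + L)).filter (fun n => n % q = a)).card : ℕ) : ℝ) ≤ (L : ℝ) / q + 1 := by
  rcases Nat.eq_zero_or_pos q with rfl | hq
  · have h : (Ico u (u + L)).filter (fun n => n % 0 = a) ⊆ {a} := by
      intro n hn
      rw [Finset.mem_filter, Nat.mod_zero] at hn
      rw [Finset.mem_singleton]
      exact hn.2
    have h1 : ((Ico u (u + L)).filter (fun n => n % 0 = a)).card ≤ 1 :=
      (Finset.card_le_card h).trans (Finset.card_singleton a).le
    simp only [Nat.cast_zero, div_zero, zero_add]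
    exact_mod_cast h1
  · have hmaps : Set.MapsTo (fun n => (n - u) / q)
        ↑((Ico u (u + L)).filter (fun n => n % q = a)) ↑(range ((L - 1) / q + 1)) := by
      intro n hn
      rw [Finset.coe_filter, Set.mem_setOf_eq, Finset.mem_Ico] at hn
      rw [Finset.mem_coe, Finset.mem_range, Nat.lt_succ_iff]
      exact Nat.div_le_div_right (by omega)
    have hinj : Set.InjOn (fun n => (n - u) / q)
        ↑((Ico u (u + L)).filter (fun n => n % q = a)) := by
      intro n hn n' hn' h
      rw [Finset.coe_filter, Set.mem_setOf_eq, Finset.mem_Ico] at hn hn'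
      have hk : q * ((n - u) / q) = q * ((n' - u) / q) := congrArg (q * ·) h
      have h1 := Nat.div_add_mod (n - u) q
      have h2 := Nat.div_add_mod (n' - u) q
      have h3 := Nat.mod_lt (n - u) hq
      have h4 := Nat.mod_lt (n' - u) hq
      have hmod : n ≡ n' [MOD q] := hn.2.trans hn'.2.symm
      refine hmod.eq_of_abs_lt ?_
      rw [abs_lt]
      constructor <;> omega
    have hcard := Finset.card_le_card_of_injOn _ hmaps hinj
    rw [Finset.card_range] at hcard
    calc ((((Ico u (u + L)).filter (fun n => n % q = a)).card : ℕ) : ℝ)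
        ≤ (((L - 1) / q + 1 : ℕ) : ℝ) := by exact_mod_cast hcard
      _ = (((L - 1) / q : ℕ) : ℝ) + 1 := by push_cast; ring
      _ ≤ ((L - 1 : ℕ) : ℝ) / q + 1 := by
          gcongr
          exact Nat.cast_div_le
      _ ≤ (L : ℝ) / q + 1 := by
          gcongr
          exact_mod_cast Nat.sub_le L 1

/-- **A class sum of a `1`-bounded sequence over `L` consecutive naturals is at most `L / q + 1` in
absolute value** (`Finset.abs_sum_le_sum_abs` and `card_filter_mod_le`). [folklore] -/
private lemma abs_sum_filter_le (c : ℕ → ℝ) (hc : ∀ n, |c n| ≤ 1) (q a u L : ℕ) :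
    |∑ n ∈ (Ico u (u + L)).filter (fun n => n % q = a), c n| ≤ (L : ℝ) / q + 1 :=
  calc |∑ n ∈ (Ico u (u + L)).filter (fun n => n % q = a), c n|
      ≤ ∑ n ∈ (Ico u (u + L)).filter (fun n => n % q = a), |c n| := Finset.abs_sum_le_sum_abs _ _
    _ ≤ ∑ n ∈ (Ico u (u + L)).filter (fun n => n % q = a), (1 : ℝ) :=
        Finset.sum_le_sum fun n _ => hc n
    _ = ((((Ico u (u + L)).filter (fun n => n % q = a)).card : ℕ) : ℝ) := by
        rw [Finset.sum_const, nsmul_eq_mul, mul_one]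
    _ ≤ (L : ℝ) / q + 1 := card_filter_mod_le q a u L

/-- **Splitting a class sum over `[u, w)` at an intermediate point `v`**
(`Finset.Ico_union_Ico_eq_Ico`, `Finset.filter_union`, `Finset.sum_union`). [folklore] -/
private lemma sum_filter_Ico_split (c : ℕ → ℝ) (q a : ℕ) {u v w : ℕ} (huv : u ≤ v) (hvw : v ≤ w) :
    ∑ n ∈ (Ico u w).filter (fun n => n % q = a), c n =
      ∑ n ∈ (Ico u v).filter (fun n => n % q = a), c n +
        ∑ n ∈ (Ico v w).filter (fun n => n % q = a), c n := by
  rw [← Finset.Ico_union_Ico_eq_Ico huv hvw, Finset.filter_union,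
    Finset.sum_union (Finset.disjoint_filter_filter (Finset.Ico_disjoint_Ico_consecutive u v w))]

/-- **The block minus a window to its right.** For `B ≤ m` and `m + 1 ≤ B + H`:
`S_block − W_m = Σ_{[B, m+1) ∩ class} c − Σ_{[B+H, m+H+1) ∩ class} c`, where
`S_block = Σ_{[B, B+H) ∩ class} c` and `W_m = Σ_{(m, m+H] ∩ class} c` (class `= {n : n % q = a}`):
write `(m, m + H] = [m + 1, m + H + 1)` (`Finset.Ico_add_one_add_one_eq_Ioc`) and split both
intervals at the common part `[m + 1, B + H)` (`sum_filter_Ico_split`). [folklore] -/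
private lemma block_sub_window_eq (c : ℕ → ℝ) (q a : ℕ) {B H m : ℕ} (hBm : B ≤ m)
    (hmH : m + 1 ≤ B + H) :
    ∑ n ∈ (Ico B (B + H)).filter (fun n => n % q = a), c n -
        ∑ n ∈ (Ioc m (m + H)).filter (fun n => n % q = a), c n =
      ∑ n ∈ (Ico B (m + 1)).filter (fun n => n % q = a), c n -
        ∑ n ∈ (Ico (B + H) (m + H + 1)).filter (fun n => n % q = a), c n := by
  rw [← Finset.Ico_add_one_add_one_eq_Ioc m (m + H),
    sum_filter_Ico_split c q a (show B ≤ m + 1 by omega) hmH,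
    sum_filter_Ico_split c q a hmH (show B + H ≤ m + H + 1 by omega)]
  ring

/-- **An aligned block against one window to its right.** For a `1`-bounded `c`, `T ≤ H` and
`m ∈ [B, B + T)`: `|S_block − W_m| ≤ 2 (T / q + 1)`: by `block_sub_window_eq` (applicable since
`m + 1 ≤ B + T ≤ B + H`) the difference is a difference of two class sums over `m + 1 − B ≤ T`
consecutive integers each, each of absolute value `≤ T / q + 1` (`abs_sum_filter_le`). [folklore] -/
private lemma block_sub_window_le (c : ℕ → ℝ) (hc : ∀ n, |c n| ≤ 1) (q a B H T : ℕ) (hTH : T ≤ H)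
    {m : ℕ} (hm : m ∈ Ico B (B + T)) :
    |∑ n ∈ (Ico B (B + H)).filter (fun n => n % q = a), c n -
        ∑ n ∈ (Ioc m (m + H)).filter (fun n => n % q = a), c n| ≤ 2 * ((T : ℝ) / q + 1) := by
  rw [Finset.mem_Ico] at hm
  obtain ⟨t, ht⟩ : ∃ t, m + 1 = B + t := ⟨m + 1 - B, by omega⟩
  have htT : (t : ℝ) ≤ T := by exact_mod_cast (show t ≤ T by omega)
  rw [block_sub_window_eq c q a hm.1 (by omega), ht, show m + H + 1 = B + H + t by omega]
  calc |∑ n ∈ (Ico B (B + t)).filter (fun n => n % q = a), c n -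
          ∑ n ∈ (Ico (B + H) (B + H + t)).filter (fun n => n % q = a), c n|
      ≤ |∑ n ∈ (Ico B (B + t)).filter (fun n => n % q = a), c n| +
          |∑ n ∈ (Ico (B + H) (B + H + t)).filter (fun n => n % q = a), c n| := abs_sub _ _
    _ ≤ ((t : ℝ) / q + 1) + ((t : ℝ) / q + 1) :=
        add_le_add (abs_sum_filter_le c hc q a B t) (abs_sum_filter_le c hc q a (B + H) t)
    _ ≤ ((T : ℝ) / q + 1) + ((T : ℝ) / q + 1) := by gcongr
    _ = 2 * ((T : ℝ) / q + 1) := by ring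

/-- **Stub KMT window average in a residue class (an aligned block against the windows to its
right).** For a `1`-bounded real sequence `c`, a modulus `q` and residue `a`, a block `[B, B + H)`
and an averaging length `0 < T ≤ H`:
`|Σ_{n ∈ [B, B+H), n % q = a} c n| ≤ T⁻¹ Σ_{m ∈ [B, B+T)} |Σ_{n ∈ (m, m+H], n % q = a} c n| + E`
with `E = 2 (T / q + 1)`
(for each `m ∈ [B, B + T)` the block sum and the window sum over `(m, m + H]` differ by at most
`2 (T / q + 1)`, `block_sub_window_le`, so `|S| ≤ |W_m| + 2 (T / q + 1)`; average over the `T`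
values of `m`). No hypothesis `0 < q`: for `q = 0` the class is `{a}` and `T / 0 = 0`.
[folklore] -/
theorem stub_kmt_window_average_AP (c : ℕ → ℝ) (hc : ∀ n, |c n| ≤ 1) (q a B H T : ℕ) (hT : 0 < T)
    (hTH : T ≤ H) :
    |∑ n ∈ (Ico B (B + H)).filter (fun n => n % q = a), c n| ≤
      (1 / (T : ℝ)) * ∑ m ∈ Ico B (B + T), |∑ n ∈ (Ioc m (m + H)).filter (fun n => n % q = a), c n| +
        2 * ((T : ℝ) / q + 1) := by
  have hT' : (0 : ℝ) < T := by exact_mod_cast hT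
  -- termwise: `|S| ≤ |W_m| + 2 (T / q + 1)` for every `m ∈ [B, B + T)`
  have hpt : ∀ m ∈ Ico B (B + T),
      |∑ n ∈ (Ico B (B + H)).filter (fun n => n % q = a), c n| ≤
        |∑ n ∈ (Ioc m (m + H)).filter (fun n => n % q = a), c n| + 2 * ((T : ℝ) / q + 1) := by
    intro m hm
    have h := block_sub_window_le c hc q a B H T hTH hm
    have h' := abs_sub_abs_le_abs_sub (∑ n ∈ (Ico B (B + H)).filter (fun n => n % q = a), c n)
      (∑ n ∈ (Ioc m (m + H)).filter (fun n => n % q = a), c n)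
    linarith
  -- sum over `m ∈ [B, B + T)`: `T |S| ≤ Σ_m |W_m| + T ⬝ 2 (T / q + 1)`
  have step : (T : ℝ) * |∑ n ∈ (Ico B (B + H)).filter (fun n => n % q = a), c n| ≤
      ∑ m ∈ Ico B (B + T), |∑ n ∈ (Ioc m (m + H)).filter (fun n => n % q = a), c n| +
        (T : ℝ) * (2 * ((T : ℝ) / q + 1)) := by
    calc (T : ℝ) * |∑ n ∈ (Ico B (B + H)).filter (fun n => n % q = a), c n|
        = ∑ m ∈ Ico B (B + T), |∑ n ∈ (Ico B (B + H)).filter (fun n => n % q = a), c n| := by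
          rw [Finset.sum_const, Nat.card_Ico, Nat.add_sub_cancel_left, nsmul_eq_mul]
      _ ≤ ∑ m ∈ Ico B (B + T),
            (|∑ n ∈ (Ioc m (m + H)).filter (fun n => n % q = a), c n| + 2 * ((T : ℝ) / q + 1)) :=
          Finset.sum_le_sum hpt
      _ = ∑ m ∈ Ico B (B + T), |∑ n ∈ (Ioc m (m + H)).filter (fun n => n % q = a), c n| +
            (T : ℝ) * (2 * ((T : ℝ) / q + 1)) := by
          rw [Finset.sum_add_distrib, Finset.sum_const, Nat.card_Ico, Nat.add_sub_cancel_left,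
            nsmul_eq_mul]
  -- divide by `T`
  have h2 : |∑ n ∈ (Ico B (B + H)).filter (fun n => n % q = a), c n| ≤
      (∑ m ∈ Ico B (B + T), |∑ n ∈ (Ioc m (m + H)).filter (fun n => n % q = a), c n| +
        (T : ℝ) * (2 * ((T : ℝ) / q + 1))) / T := by
    rw [le_div_iff₀ hT']
    linarith [step]
  calc |∑ n ∈ (Ico B (B + H)).filter (fun n => n % q = a), c n|
      ≤ (∑ m ∈ Ico B (B + T), |∑ n ∈ (Ioc m (m + H)).filter (fun n => n % q = a), c n| +
          (T : ℝ) * (2 * ((T : ℝ) / q + 1))) / T := h2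
    _ = (1 / (T : ℝ)) *
            ∑ m ∈ Ico B (B + T), |∑ n ∈ (Ioc m (m + H)).filter (fun n => n % q = a), c n| +
          2 * ((T : ℝ) / q + 1) := by
        rw [add_div, mul_div_cancel_left₀ _ hT'.ne', one_div_mul_eq_div]

end Summit.QuantumAdvantage.DigitPolyUniformity.SketchLAR.KMT

end
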